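import Literature.NumberTheory.Sieve.LargestPrimeFactorCubicSetup
import Literature.NumberTheory.Sieve.LargestPrimeFactorCubicHBWeights
import Literature.NumberTheory.Sieve.LargestPrimeFactorCubicFinal
import HarnessLib

/-!
# Heath-Brown 2001, §2 for an ARBITRARY generator family: `S ≤ ∑ W(n)`, `W(n) ≤ min(Ω,321)2^Ω`,
# and both named facts from `S ≥ cX`

Topic `Literature/NumberTheory/Sieve`; a PROVED structural layer (definitions with bodies, no named
facts) under the named facts `Irving2015_largestPrimeFactor_cubic` and
`HeathBrown2001_largestPrimeFactor_cubic` (`LargestPrimeFactorCubic.lean`; D. R. Heath-Brown, *The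
largest prime factor of `X³ + 2`*, Proc. London Math. Soc. (3) 82 (2001) 554–596, §2; A. J. Irving,
*The largest prime factor of `X³ + 2`*, Acta Arith. 171 (2015), §2).

`LargestPrimeFactorCubicSetup.lean` (the parallel seat of the Heath-Brown fact) sets up Heath-Brown's
weighted count `S = ∑_K ∑_{L ∈ 𝓛(K)} (∑_{d ∣ (Q,N(L))} λ_d) #𝒜_{KL} = X S₀ + S₁` and the weights
`W(n)` for ONE EXPLICIT generator family `gens X P` (a thin family of cubes at geometric scales,
deliberately cruder than Heath-Brown's region `𝓡` of (2.12)–(2.13): "only lowers `S₀` by a constant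
factor (immaterial by `…HBWeights`, which needs `∑ W ≥ 10⁻⁹⁰X`)").  Irving's exponent `ϖ = 10⁻⁵²`
has no such slack: `Irving2015_largestPrimeFactor_cubic_of_HeathBrown_sieve` (`…Final.lean`) needs
`∑ W ≥ (9.2·10⁻⁸ − 10⁻⁹)X`, i.e. Heath-Brown's own main term over (essentially all of) `𝓡`, cut into
good cubes of side `o(N)` as in his §8.  The four structural facts of §2 do not depend on the shape
of the generator set, so this file re-proves them for an ARBITRARY finite set `G` of generator
triples `(a, b, c)` (`α = a + b∛2 + c∛4`), with the Setup file's weights `λ_d` (`lam`), sieve weight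
`wt`, counts `Acount`, `𝒦`-primes `kPrimes` and `Q = P(X^δ)` (`sievePrimes`) unchanged:

* `pairsG`, `SsumG`, `S0sumG`, `S1sumG`, `WtG` — `S`, `S₀`, `S₁`, `W` over `G` (so that
  `SsumG X (gens X P) = Ssum X P` etc. definitionally, `SsumG_gens`);
* `SsumG_eq` — `S = X S₀ + S₁`; `SsumG_le_sum_WtG` — `S ≤ ∑_{X<n≤2X} W(n)` ((2.7));
* `WtG_pos_imp` — `W(n) > 0 ⇒ n³ + 2` has the divisor `N(α) > X^{1+δ}` with prime factors `≤ 3X`,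
  for any `G` whose norms lie in `(X^{1+δ}, X^{1+2δ}]` ((2.3));
* `WtG_le` — `W(n) ≤ min(Ω(n), 321) 2^{Ω(n)}` for any such `G` on which `α ↦ (α)` is injective
  ("the ideals `(α)` are distinct", p. 563; Lemma 1 via `eq_of_natCast_add_θint_mem_of_absNorm_eq`);
* **`sieveInput_of_frame`** — for generator families `G X` with (2.3) and distinct ideals for all
  large `X`, `S ≥ cX` eventually gives the common input (A) of both facts (weights `W` with
  `∑ W ≥ cX`, `W > 0 ⇒ log^{(1)} ≥ (1 + 1/321) log X`, `W ≤ min(Ω,321)2^Ω`);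
* **`Irving2015_largestPrimeFactor_cubic_of_frame`** (`c = 9.2·10⁻⁸ − 10⁻⁹`) and
  **`HeathBrown2001_largestPrimeFactor_cubic_of_frame`** (any `c ≥ 10⁻⁹⁰`).

What remains for Irving's theorem is therefore: a generator family `G X ⊆ 𝓡` (good cubes, §8) with
`S(G X) ≥ (9.2·10⁻⁸ − 10⁻⁹)X` for large `X` — Heath-Brown's Lemma 5 (`S₁ = o(X)`, from Theorem 2,
the named fact `HeathBrown2001_thm2_shortKloosterman`) and Lemmas 6–8 (`S₀ ≥ C₂C₃L(δ) + o(1)`, whose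
constants are proved in `…KProduct`, `…MertensG`, `…MertensWindows`).

## References

* D. R. Heath-Brown, *The largest prime factor of `X³ + 2`*, Proc. London Math. Soc. (3) 82 (2001)
  554–596, §2 pp. 559–563 ((2.3), (2.7), Lemma 3, "the ideals `(α)` are distinct").
  [`HeathBrown2001LargestPrimeFactorCubic`]
* A. J. Irving, *The largest prime factor of `X³ + 2`*, arXiv:1412.0024; Acta Arith. 171 (2015)
  67–80, §2 p. 4 (`W ≤ min(Ω_δ, [1/δ]) 2^{Ω_δ}`). [`Irving2014LargestPrimeFactorCubic`]

## Mathlib / tree search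

Tree: `LargestPrimeFactorCubicSetup` (`hbδ`, `normNat`, `genIdeal`, `kPrimes`, `mem_kPrimes`,
`sievePrimes`, `lam`, `wt`, `wt_le`, `Acount`, `gens`, `pairsVP`, `Ssum`, `Wt`,
`card_rough_divisors_le`, `card_le_of_prime_dvd` — the proofs below are those of `S_eq`,
`S_le_sum_W`, `W_pos_imp`, `W_le` with `gens X P` replaced by `G`), `LargestPrimeFactorCubicIdeals`
(`absNorm_dvd_of_natCast_add_θint_mem`, `eq_of_natCast_add_θint_mem_of_absNorm_eq`),
`LargestPrimeFactorCubicChebyshev` (`log_le_smoothLog_of_dvd`), `…HBWeights`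
(`HeathBrown2001_largestPrimeFactor_cubic_of_weights`), `…Final`
(`Irving2015_largestPrimeFactor_cubic_of_HeathBrown_sieve`).
-/

noncomputable section

open NumberField Finset Filter Real

namespace Literature.NumberTheory.Sieve.HeathBrown2001

open LFunctions.CubeRootTwoField CubicSieve LargestPrimeFactorCubic BetaSieve

/-! ### `S`, `S₀`, `S₁`, `W` over an arbitrary generator set `G` -/

/-- The index set of `S` for a generator set `G`: pairs `(α, p)`, `α ∈ G`, `p ∈ 𝒦`, `p ∣ N(α)`.
[cite: HeathBrown2001LargestPrimeFactorCubic, §2 p. 561] -/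
def pairsG (X : ℕ) (G : Finset (ℕ × ℕ × ℕ)) : Finset ((ℕ × ℕ × ℕ) × ℕ) :=
  (G ×ˢ kPrimes X).filter fun vp => vp.2 ∣ normNat vp.1

/-- `S = ∑_{(α,p)} (∑_{d ∣ (Q, N(α)/p)} λ_d) #𝒜_{(α)}` over `G`. [cite: HeathBrown2001LargestPrimeFactorCubic, §2 p. 561] -/
def SsumG (X : ℕ) (G : Finset (ℕ × ℕ × ℕ)) : ℝ :=
  ∑ vp ∈ pairsG X G, wt X vp.1 vp.2 * Acount X vp.1

/-- `S₀ = ∑_{(α,p)} (∑_d λ_d)/N(α)` over `G`. [cite: HeathBrown2001LargestPrimeFactorCubic, §2 p. 561] -/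
def S0sumG (X : ℕ) (G : Finset (ℕ × ℕ × ℕ)) : ℝ :=
  ∑ vp ∈ pairsG X G, wt X vp.1 vp.2 / normNat vp.1

/-- `S₁ = ∑_{(α,p)} (∑_d λ_d) R_{(α)}`, `R_I = #𝒜_I − X/N(I)`, over `G`.
[cite: HeathBrown2001LargestPrimeFactorCubic, §2 p. 561] -/
def S1sumG (X : ℕ) (G : Finset (ℕ × ℕ × ℕ)) : ℝ :=
  ∑ vp ∈ pairsG X G, wt X vp.1 vp.2 * ((Acount X vp.1 : ℝ) - X / normNat vp.1)

open scoped Classical in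
/-- `W(n) = #{(α, p) : (α) ∋ n + ∛2, p ∣ N(α), (N(α)/p, Q) = 1}` over `G`.
[cite: HeathBrown2001LargestPrimeFactorCubic, §2 p. 561] -/
def WtG (X : ℕ) (G : Finset (ℕ × ℕ × ℕ)) (n : ℕ) : ℕ :=
  #((pairsG X G).filter fun vp =>
      (n : 𝓞 K) + θint ∈ genIdeal vp.1 ∧ (normNat vp.1 / vp.2).Coprime (sievePrimes X))

/-- The Setup file's objects are the case `G = gens X P`. [folklore] -/
theorem pairsG_gens (X : ℕ) (P : ℕ → Finset (ℕ × ℕ)) : pairsG X (gens X P) = pairsVP X P := rfl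

/-- `SsumG X (gens X P) = Ssum X P`. [folklore] -/
theorem SsumG_gens (X : ℕ) (P : ℕ → Finset (ℕ × ℕ)) : SsumG X (gens X P) = Ssum X P := rfl

/-- `WtG X (gens X P) = Wt X P`. [folklore] -/
theorem WtG_gens (X : ℕ) (P : ℕ → Finset (ℕ × ℕ)) : WtG X (gens X P) = Wt X P := rfl

/-- **`S = X S₀ + S₁`** over `G`. [cite: HeathBrown2001LargestPrimeFactorCubic, §2 p. 561] -/
theorem SsumG_eq (X : ℕ) (G : Finset (ℕ × ℕ × ℕ)) : SsumG X G = X * S0sumG X G + S1sumG X G := by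
  rw [SsumG, S0sumG, S1sumG, mul_sum, ← sum_add_distrib]
  refine sum_congr rfl (fun vp _ => ?_)
  ring

open scoped Classical in
/-- **`S ≤ ∑_{X < n ≤ 2X} W(n)`** over `G` (by (2.7), `wt_le`).
[cite: HeathBrown2001LargestPrimeFactorCubic, §2 p. 561] -/
theorem SsumG_le_sum_WtG (X : ℕ) (G : Finset (ℕ × ℕ × ℕ)) :
    SsumG X G ≤ ∑ n ∈ Ioc X (2 * X), (WtG X G n : ℝ) := by
  have hW : ∀ n, (WtG X G n : ℝ) = ∑ vp ∈ pairsG X G,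
      if (n : 𝓞 K) + θint ∈ genIdeal vp.1 ∧ (normNat vp.1 / vp.2).Coprime (sievePrimes X)
      then (1 : ℝ) else 0 := by
    intro n
    rw [WtG, Finset.card_filter]
    push_cast
    rfl
  have hA : ∀ v, (Acount X v : ℝ) = ∑ n ∈ Ioc X (2 * X),
      if (n : 𝓞 K) + θint ∈ genIdeal v then (1 : ℝ) else 0 := by
    intro v
    rw [Acount, Finset.card_filter]
    push_cast
    rfl
  simp_rw [hW]
  rw [Finset.sum_comm, SsumG]
  refine sum_le_sum (fun vp _ => ?_)
  rw [hA, mul_sum]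
  refine sum_le_sum (fun n _ => ?_)
  have hwt := wt_le X vp.1 vp.2
  by_cases hmem : (n : 𝓞 K) + θint ∈ genIdeal vp.1
  · simp only [hmem, true_and, if_true, mul_one]
    exact hwt
  · simp [hmem]

/-! ### `W(n) > 0 ⇒ n ∈ 𝒜^{(1)}` -/

open scoped Classical in
/-- **`W(n) > 0 ⇒ n ∈ 𝒜^{(1)}`** in divisor form, for any `G` with norms in `(X^{1+δ}, X^{1+2δ}]`
((2.3)): `n³ + 2` has the divisor `d = N(α) > X^{1+1/321}` with all prime factors `≤ 3X`
(`N(K) ≤ X^{4δ}`, `N(L) ≤ X^{1−δ}`). [cite: HeathBrown2001LargestPrimeFactorCubic, §2 p. 560] -/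
theorem WtG_pos_imp {X : ℕ} {G : Finset (ℕ × ℕ × ℕ)} (hX : 1 ≤ X)
    (hlo : ∀ v ∈ G, (X : ℝ) ^ (1 + hbδ) < normNat v)
    (hhi : ∀ v ∈ G, (normNat v : ℝ) ≤ (X : ℝ) ^ (1 + 2 * hbδ))
    {n : ℕ} (hW : 0 < WtG X G n) :
    ∃ d : ℕ, d ∣ n ^ 3 + 2 ∧ (X : ℝ) ^ (1 + (1 : ℝ) / 321) < d ∧
      ∀ p : ℕ, p.Prime → p ∣ d → p ≤ 3 * X := by
  rw [WtG, card_pos] at hW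
  obtain ⟨⟨v, p⟩, hvp⟩ := hW
  rw [mem_filter] at hvp
  obtain ⟨hvp, hmem, -⟩ := hvp
  rw [pairsG, mem_filter, mem_product] at hvp
  obtain ⟨⟨hv, hp⟩, hpd⟩ := hvp
  simp only at hmem hpd hv hp
  obtain ⟨hpP, hp1, hp2⟩ := mem_kPrimes hp
  have hN1 := hlo v hv
  have hN2 := hhi v hv
  have hX1 : (1 : ℝ) ≤ X := by exact_mod_cast hX
  have hNpos : 0 < normNat v := by
    have h0 : (0 : ℝ) < normNat v := lt_of_le_of_lt (by positivity) hN1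
    exact_mod_cast h0
  refine ⟨normNat v, ?_, ?_, ?_⟩
  · rw [← absNorm_genIdeal]; exact absNorm_dvd_of_natCast_add_θint_mem hmem
  · have e : (1 : ℝ) + 1 / 321 = 1 + hbδ := by unfold hbδ; norm_num
    rw [e]; exact hN1
  · intro ℓ hℓ hℓd
    obtain ⟨m, hm⟩ := hpd
    rw [hm] at hℓd
    rcases (Nat.Prime.dvd_mul hℓ).1 hℓd with h | h
    · have hle : ℓ ≤ p := Nat.le_of_dvd hpP.pos h
      have : (p : ℝ) ≤ 3 * X := by
        refine hp2.trans ?_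
        calc (X : ℝ) ^ (4 * hbδ) ≤ (X : ℝ) ^ (1 : ℝ) :=
              Real.rpow_le_rpow_of_exponent_le hX1 (by unfold hbδ; norm_num)
          _ = X := Real.rpow_one _
          _ ≤ 3 * X := by linarith
      exact_mod_cast (show (ℓ : ℝ) ≤ 3 * X from le_trans (by exact_mod_cast hle) this)
    · have hm0 : 0 < m := by
        rcases Nat.eq_zero_or_pos m with h0 | h0
        · rw [h0, mul_zero] at hm; omega
        · exact h0
      have hle : ℓ ≤ m := Nat.le_of_dvd hm0 h
      have hmreal : (m : ℝ) * p = normNat v := by rw [hm]; push_cast; ring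
      have hX0 : (0 : ℝ) < X := by linarith
      have key : (m : ℝ) ≤ X := by
        have h1 : (m : ℝ) * (X : ℝ) ^ (3 * hbδ) ≤ (X : ℝ) ^ (1 + 2 * hbδ) := by
          calc (m : ℝ) * (X : ℝ) ^ (3 * hbδ) ≤ (m : ℝ) * p :=
                mul_le_mul_of_nonneg_left hp1.le (Nat.cast_nonneg m)
            _ = normNat v := hmreal
            _ ≤ (X : ℝ) ^ (1 + 2 * hbδ) := hN2
        have h2 : (X : ℝ) ^ (1 + 2 * hbδ) ≤ X * (X : ℝ) ^ (3 * hbδ) := by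
          rw [show (X : ℝ) * (X : ℝ) ^ (3 * hbδ) = (X : ℝ) ^ (1 + 3 * hbδ) by
            rw [Real.rpow_add hX0, Real.rpow_one]]
          exact Real.rpow_le_rpow_of_exponent_le hX1 (by linarith [hbδ_pos])
        have h3 : (0 : ℝ) < (X : ℝ) ^ (3 * hbδ) := Real.rpow_pos_of_pos hX0 _
        nlinarith
      have : (ℓ : ℝ) ≤ 3 * X := by
        have : (ℓ : ℝ) ≤ m := by exact_mod_cast hle
        linarith
      exact_mod_cast this

/-! ### `W(n) ≤ min(Ω(n), 321) · 2^{Ω(n)}` -/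

open scoped Classical in
/-- **`W(n) ≤ min(Ω(n), 321) · 2^{Ω(n)}`** for any `G` with norms in `(X^{1+δ}, X^{1+2δ}]` and
pairwise distinct ideals `(α)` (p. 561 with Irving's bookkeeping): `(α, p) ↦ (N(α)/p, p)` is
injective on the pairs counted by `W(n)` (Lemma 1), with image in
`{X^δ-rough divisors of n³+2} × {primes p ∣ n³+2, p > X^{3δ}}`.
[cite: HeathBrown2001LargestPrimeFactorCubic, §2 p. 561] [cite: Irving2014LargestPrimeFactorCubic, §2 p. 4] -/
theorem WtG_le {X : ℕ} {G : Finset (ℕ × ℕ × ℕ)} (hX : 1 ≤ X)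
    (hinj : Set.InjOn genIdeal (G : Set (ℕ × ℕ × ℕ)))
    (hX322 : 10 * (X : ℝ) ^ 3 < ((X : ℝ) ^ (3 * hbδ)) ^ (321 + 1)) {n : ℕ} (hn : n ∈ Ioc X (2 * X)) :
    WtG X G n ≤
      min ((Nat.primeFactorsList (n ^ 3 + 2)).filter (fun p => ⌈(X : ℝ) ^ hbδ⌉₊ ≤ p)).length 321 *
        2 ^ ((Nat.primeFactorsList (n ^ 3 + 2)).filter (fun p => ⌈(X : ℝ) ^ hbδ⌉₊ ≤ p)).length := by
  set m := n ^ 3 + 2 with hmdef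
  set z := ⌈(X : ℝ) ^ hbδ⌉₊ with hz
  have hm0 : m ≠ 0 := by positivity
  have hX1 : (1 : ℝ) ≤ X := by exact_mod_cast hX
  set T := (pairsG X G).filter fun vp =>
      (n : 𝓞 K) + θint ∈ genIdeal vp.1 ∧ (normNat vp.1 / vp.2).Coprime (sievePrimes X) with hT
  set R := m.divisors.filter (fun d => ∀ p ∈ d.primeFactors, z ≤ p) with hR
  set Kp := m.primeFactors.filter (fun p : ℕ => (X : ℝ) ^ (3 * hbδ) < (p : ℝ)) with hKp
  have hmaps : ∀ vp ∈ T, (normNat vp.1 / vp.2, vp.2) ∈ R ×ˢ Kp := by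
    rintro ⟨v, p⟩ hvp
    rw [hT, mem_filter, pairsG, mem_filter, mem_product] at hvp
    obtain ⟨⟨⟨hv, hp⟩, hpd⟩, hmem, hcop⟩ := hvp
    simp only at hv hp hpd hmem hcop ⊢
    obtain ⟨hpP, hp1, hp2⟩ := mem_kPrimes hp
    have hNd : normNat v ∣ m := by
      rw [← absNorm_genIdeal]; exact absNorm_dvd_of_natCast_add_θint_mem hmem
    obtain ⟨q, hq⟩ := hpd
    rw [mem_product]
    constructor
    · rw [hR, mem_filter, Nat.mem_divisors]
      refine ⟨⟨?_, hm0⟩, fun ℓ hℓ => ?_⟩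
      · exact (Nat.div_dvd_of_dvd ⟨q, hq⟩).trans hNd
      · have hℓP := Nat.prime_of_mem_primeFactors hℓ
        have hℓd := Nat.dvd_of_mem_primeFactors hℓ
        have hnot : ¬ ℓ ∣ sievePrimes X := fun h => by
          have h1 := Nat.dvd_gcd hℓd h
          rw [hcop.gcd_eq_one, Nat.dvd_one] at h1
          exact hℓP.one_lt.ne' h1
        rw [sievePrimes, dvd_primesProdBelow_iff hℓP] at hnot
        push Not at hnot
        exact Nat.ceil_le.2 hnot
    · rw [hKp, mem_filter, Nat.mem_primeFactors]
      exact ⟨⟨hpP, (dvd_mul_right p q).trans (hq ▸ hNd), hm0⟩, hp1⟩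
  have hinjT : Set.InjOn (fun vp : (ℕ × ℕ × ℕ) × ℕ => (normNat vp.1 / vp.2, vp.2)) T := by
    rintro ⟨v, p⟩ hvp ⟨w, p'⟩ hwp h
    simp only [Prod.mk.injEq] at h
    obtain ⟨h1, rfl⟩ := h
    rw [hT, mem_coe, mem_filter, pairsG, mem_filter, mem_product] at hvp hwp
    obtain ⟨⟨⟨hv, hp⟩, hpv⟩, hmemv, -⟩ := hvp
    obtain ⟨⟨⟨hw, -⟩, hpw⟩, hmemw, -⟩ := hwp
    simp only at hv hp hpv hmemv hw hpw hmemw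
    have hN : normNat v = normNat w := by
      rw [← Nat.div_mul_cancel hpv, ← Nat.div_mul_cancel hpw, h1]
    have hJ : genIdeal v = genIdeal w :=
      eq_of_natCast_add_θint_mem_of_absNorm_eq hmemv hmemw
        (by rw [absNorm_genIdeal, absNorm_genIdeal, hN])
    rw [hinj (mem_coe.2 hv) (mem_coe.2 hw) hJ]
  have hcard : #T ≤ #R * #Kp := by
    calc #T ≤ #(R ×ˢ Kp) := card_le_card_of_injOn _ hmaps hinjT
      _ = #R * #Kp := card_product _ _
  rw [WtG]
  refine hcard.trans ?_
  rw [mul_comm]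
  refine Nat.mul_le_mul ?_ (card_rough_divisors_le m z hm0)
  refine le_min ?_ ?_
  · have hsub : Kp ⊆ (m.primeFactorsList.filter (fun p => z ≤ p)).toFinset := by
      intro p hp
      rw [hKp, mem_filter] at hp
      rw [List.mem_toFinset, List.mem_filter]
      refine ⟨Nat.mem_primeFactors_iff_mem_primeFactorsList.1 hp.1, ?_⟩
      have : (X : ℝ) ^ hbδ ≤ p := by
        refine le_trans ?_ hp.2.le
        exact Real.rpow_le_rpow_of_exponent_le hX1 (by linarith [hbδ_pos])
      simpa [hz] using Nat.ceil_le.2 this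
    exact (card_le_card hsub).trans (List.toFinset_card_le _)
  · refine card_le_of_prime_dvd (y := (X : ℝ) ^ (3 * hbδ)) (Real.one_le_rpow hX1 (by
      linarith [hbδ_pos])) hm0 (fun p hp => ?_) ?_
    · rw [hKp, mem_filter, Nat.mem_primeFactors] at hp
      exact ⟨hp.1.1, hp.2, hp.1.2.1⟩
    · refine lt_of_le_of_lt ?_ hX322
      rw [mem_Ioc] at hn
      have h1 : m ≤ 10 * X ^ 3 := by
        have h2 := Nat.pow_le_pow_left hn.2 3
        have hx3 : 1 ≤ X ^ 3 := Nat.one_le_pow _ _ hX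
        have e1 : (2 * X) ^ 3 = 8 * X ^ 3 := by ring
        rw [hmdef]; rw [e1] at h2; omega
      exact_mod_cast h1

/-! ### Both facts from `S ≥ cX` for an admissible generator family -/

/-- `10X³ < (X^{3δ})^{322} = X^{3+3/321}` for all large `X`. [folklore] -/
theorem eventually_hX322 : ∀ᶠ X : ℕ in atTop, 10 * (X : ℝ) ^ 3 < ((X : ℝ) ^ (3 * hbδ)) ^ (321 + 1) := by
  have h1 : Tendsto (fun X : ℕ => ((X : ℝ)) ^ ((3 : ℝ) / 321)) atTop atTop :=
    (tendsto_rpow_atTop (by norm_num)).comp tendsto_natCast_atTop_atTop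
  filter_upwards [h1.eventually_gt_atTop 10, eventually_ge_atTop 1] with X hX hX1
  have hX0 : (0 : ℝ) < X := by exact_mod_cast hX1
  have e : ((X : ℝ) ^ (3 * hbδ)) ^ (321 + 1) = (X : ℝ) ^ 3 * (X : ℝ) ^ ((3 : ℝ) / 321) := by
    rw [← Real.rpow_natCast, ← Real.rpow_mul hX0.le, show ((321 + 1 : ℕ) : ℝ) = 322 by norm_num,
      show (3 : ℝ) = ((3 : ℕ) : ℝ) by norm_num, ← Real.rpow_natCast, ← Real.rpow_add hX0]
    unfold hbδ
    norm_num
  rw [e]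
  have h3 : (0 : ℝ) < (X : ℝ) ^ 3 := by positivity
  nlinarith

/-- **The common sieve input (A) of both named facts from an admissible generator family**: if for
all large `X` the generators `G X` have norms in `(X^{1+δ}, X^{1+2δ}]` ((2.3)) and pairwise distinct
ideals ((2.13)), and `S(G X) ≥ cX`, then the weights `W = WtG X (G X)` satisfy `∑ W ≥ cX`,
`W(n) > 0 ⇒ ∑_{p ≤ 3X} v_p(n³+2) log p ≥ (1 + 1/321) log X`, `W ≤ min(Ω, 321) 2^Ω`.
[cite: HeathBrown2001LargestPrimeFactorCubic, §2 pp. 560–561, Lemma 3] -/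
theorem sieveInput_of_frame {G : ℕ → Finset (ℕ × ℕ × ℕ)} {c : ℝ}
    (hlo : ∀ᶠ X : ℕ in atTop, ∀ v ∈ G X, (X : ℝ) ^ (1 + hbδ) < normNat v)
    (hhi : ∀ᶠ X : ℕ in atTop, ∀ v ∈ G X, (normNat v : ℝ) ≤ (X : ℝ) ^ (1 + 2 * hbδ))
    (hinj : ∀ᶠ X : ℕ in atTop, Set.InjOn genIdeal (G X : Set (ℕ × ℕ × ℕ)))
    (hS : ∀ᶠ X : ℕ in atTop, c * (X : ℝ) ≤ SsumG X (G X)) :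
    ∀ᶠ X : ℕ in atTop, ∃ W : ℕ → ℕ,
      c * (X : ℝ) ≤ ∑ n ∈ Ioc X (2 * X), (W n : ℝ) ∧
      (∀ n ∈ Ioc X (2 * X), 0 < W n → (1 + 1 / 321) * Real.log X ≤
        ∑ p ∈ Nat.primesLE (3 * X), ((n ^ 3 + 2).factorization p : ℝ) * Real.log p) ∧
      (∀ n ∈ Ioc X (2 * X), W n ≤
        min ((Nat.primeFactorsList (n ^ 3 + 2)).filter
            (fun p => ⌈(X : ℝ) ^ ((1 : ℝ) / 321)⌉₊ ≤ p)).length 321 *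
          2 ^ ((Nat.primeFactorsList (n ^ 3 + 2)).filter
            (fun p => ⌈(X : ℝ) ^ ((1 : ℝ) / 321)⌉₊ ≤ p)).length) := by
  filter_upwards [hlo, hhi, hinj, hS, eventually_hX322, eventually_ge_atTop 1] with
    X hloX hhiX hinjX hSX h322 hX1
  refine ⟨WtG X (G X), hSX.trans (SsumG_le_sum_WtG X (G X)), fun n hn hW => ?_, fun n hn => ?_⟩
  · obtain ⟨d, hd, hXd, hsmooth⟩ := WtG_pos_imp hX1 hloX hhiX hW
    have hX0 : (0 : ℝ) < X := by
      have : 0 < X := by rw [mem_Ioc] at hn; omega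
      exact_mod_cast this
    calc (1 + 1 / 321) * Real.log X = Real.log ((X : ℝ) ^ (1 + (1 : ℝ) / 321)) :=
          (Real.log_rpow hX0 _).symm
      _ ≤ Real.log d := Real.log_le_log (by positivity) hXd.le
      _ ≤ _ := log_le_smoothLog_of_dvd hd hsmooth
  · have e : (1 : ℝ) / 321 = hbδ := by unfold hbδ; rfl
    rw [e]
    exact WtG_le hX1 hinjX h322 hn

/-- **Irving 2015, Theorem 1.1, from an admissible generator family with Heath-Brown's constant**:
`S(G X) ≥ (9.2·10⁻⁸ − 10⁻⁹)X` for large `X` suffices (via `…_of_HeathBrown_sieve`, `…Final.lean`).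
[cite: Irving2014LargestPrimeFactorCubic, Thm. 1.1 and Lemma 2.3] [cite: HeathBrown2001LargestPrimeFactorCubic, §2] -/
theorem Irving2015_largestPrimeFactor_cubic_of_frame {G : ℕ → Finset (ℕ × ℕ × ℕ)}
    (hlo : ∀ᶠ X : ℕ in atTop, ∀ v ∈ G X, (X : ℝ) ^ (1 + hbδ) < normNat v)
    (hhi : ∀ᶠ X : ℕ in atTop, ∀ v ∈ G X, (normNat v : ℝ) ≤ (X : ℝ) ^ (1 + 2 * hbδ))
    (hinj : ∀ᶠ X : ℕ in atTop, Set.InjOn genIdeal (G X : Set (ℕ × ℕ × ℕ)))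
    (hS : ∀ᶠ X : ℕ in atTop, (9.2 / 10 ^ 8 - 1 / 10 ^ 9) * (X : ℝ) ≤ SsumG X (G X)) :
    Irving2015_largestPrimeFactor_cubic :=
  Irving2015_largestPrimeFactor_cubic_of_HeathBrown_sieve (sieveInput_of_frame hlo hhi hinj hS)

/-- **Heath-Brown 2001, Theorem 1, from an admissible generator family**: `S(G X) ≥ cX` for large
`X` with any `c ≥ 10⁻⁹⁰` suffices (via `…_of_weights`, `…HBWeights.lean`).
[cite: HeathBrown2001LargestPrimeFactorCubic, Thm. 1 and §2] -/
theorem HeathBrown2001_largestPrimeFactor_cubic_of_frame {G : ℕ → Finset (ℕ × ℕ × ℕ)} {c : ℝ}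
    (hc : 1 / 10 ^ 90 ≤ c)
    (hlo : ∀ᶠ X : ℕ in atTop, ∀ v ∈ G X, (X : ℝ) ^ (1 + hbδ) < normNat v)
    (hhi : ∀ᶠ X : ℕ in atTop, ∀ v ∈ G X, (normNat v : ℝ) ≤ (X : ℝ) ^ (1 + 2 * hbδ))
    (hinj : ∀ᶠ X : ℕ in atTop, Set.InjOn genIdeal (G X : Set (ℕ × ℕ × ℕ)))
    (hS : ∀ᶠ X : ℕ in atTop, c * (X : ℝ) ≤ SsumG X (G X)) :
    HeathBrown2001_largestPrimeFactor_cubic :=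
  HeathBrown2001_largestPrimeFactor_cubic_of_weights hc (sieveInput_of_frame hlo hhi hinj hS)

end Literature.NumberTheory.Sieve.HeathBrown2001
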